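/-
Copyright (c) 2026 the pub-hodgecm-mathlib formalisation cell (harness21).  Prover seat hodgecm-mathlib-K2Liu-p01 (g9), Track B «K2-LIT»,
#184♮ = hLiu418 = `stmt-HodgeConjecture-24832`; #42S organ S1 ROAD W, witness TOP FILE part (W2-g) (RECIPE-F7-InertWitnessTopFile 80571dd96a2cf31d §C(hsum)):
the ANALYSIS GLUE of ★ (W2-d)∕(W2-f) — continuity of the character family and of the frame Gram, compactness∕openness of the lattice-pair boxes, integrability of the
witness, finiteness of the dual-box quotients — place-generic.
-/
import Summits.HodgeConjecture.HodgeConjecture.Theorems.K2LiuWitnessCharacterFamily     -- ★ (W2-a) the character family; quadratic coordinates on `E ⊗ F_v`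
import Summits.HodgeConjecture.HodgeConjecture.Theorems.K2LiuSkewLatticeShells          -- ★ `isOpen_setOf_valued_le`, `isCompact_setOf_valued_le`
import Summits.HodgeConjecture.HodgeConjecture.Theorems.K2LiuLocalSWDualBoxIndex        -- ★ (B5) `relIndex_inf_box_eq_pow`
import Summits.HodgeConjecture.HodgeConjecture.Theorems.K2LiuWitnessSchwartzBruhat      -- ★ (W1-d) `isCompact_preimage_equiv`, `isOpen_preimage_equiv`
import Mathlib.Topology.Algebra.Module.FiniteDimension
import Mathlib.Topology.Instances.Matrix
import Mathlib.MeasureTheory.Function.L1Space.Integrable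
import HarnessLib

/-!
# Crux `HLiu418`, #42S-S1 ROAD W, (W2-g): ANALYSIS GLUE FOR THE WITNESS PROFILE SUM — continuity, compactness, integrability, finiteness

Cell `hodgecm-mathlib`, crux item hLiu418 = `stmt-HodgeConjecture-24832` (helper lane `--supports … --as helper`, count-neutral).  THEOREMS ONLY (no `def`, no instance,
no notation, no named-fact hypothesis, no `sorry`).  Place-generic doubled local currency `(F E c δ v π T₀ ψ)`.

* §1 `continuous_im` — `im_Q : E ⊗ F_v → F_v` is continuous (finite-dimensional `F_v`-linear, ★ `quadraticLocalEquiv`); **`continuous_charFamily`** ∕ `aestronglyMeasurable_charFamily` —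
  `x ↦ ψ_v(−½·im_Q(2·tr(S t G̃(x))))` is continuous for continuous `ψ_v` and `G̃` (★ (W2-d)'s `hmeas`);
* §2 **`continuous_frameGram`** — the frame Gram `x ↦ (Σ_{k,l} b(x)_{jl} D_{kl} σ(b(x)_{ik}))_{ji}` is continuous for continuous `b` (★ `continuous_conjLocal`);
* §3 `isOpen_box_one`∕`isCompact_box_one`∕`isOpen_box_two`∕`isCompact_box_two` — the lattice-pair boxes `B₁ = {A, B ∈ 𝒪², C ∈ (ϖ^k)²} ⊇ B₂ = B₁ ∩ {B ∈ ϖ𝒪²}` in `(E_w²)³` are compact open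
  (★ `K2LiuSkewLatticeShells.isOpen∕isCompact_setOf_valued_le`);
* §4 **`integrable_indicator_sub_indicator`** — `𝟙_{κ⁻¹B₁} − 𝟙_{κ⁻¹B₂}` is integrable for `κ` a bicontinuous equivalence and a measure finite on compacts (★ (W2-d)'s `hφi`);
* §5 **`finite_quotient_inf_box`** — `(S ⊓ Λ_m)⧸(S ⊓ Λ₀)` is finite (★ (B5) `relIndex_inf_box_eq_pow`; the `Fintype` binders of ★ (T4-core)∕(W2-f) by `Fintype.ofFinite`).
[Weil1964, n° 11, n° 13] [Tate1950, §2.2] [Shimura1997, §13.2].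
HONEST LABEL.  Count-neutral helper; `HC_CM` is proved only modulo the 7 printed citations (2 remaining named inputs: hLiu418 = `stmt-HodgeConjecture-24832`,
h413 = `stmt-HodgeConjecture-24833`) until rung 0 closes.

## References
* [Weil1964] A. Weil, Acta Math. 111 (1964), n° 11, n° 13.
* [Tate1950] J. Tate, thesis (1950), in Cassels–Fröhlich (1967), §2.2.
* [Shimura1997] G. Shimura, *Euler Products and Eisenstein Series*, CBMS 93 (1997), §13.2.
-/

set_option autoImplicit false
set_option linter.dupNamespace false -- the mandated namespace repeats `HodgeConjecture.HodgeConjecture`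

noncomputable section

open NumberField IsDedekindDomain Matrix MeasureTheory
open Literature.NumberTheory.Automorphic Literature.NumberTheory.Automorphic.UnitaryGroup
open Literature.NumberTheory.Automorphic.UnitaryGroup.QuadraticCoordinates
open Literature.NumberTheory.GelbartRogawski1991.UnitaryDualPair Literature.NumberTheory.GelbartRogawski1991.UnitaryDualPair.LocalSplitting

namespace Summit.HodgeConjecture.HodgeConjecture.Cruxes.HLiu418.K2LiuWitnessPhaseMeasurable

open K2LiuLocalRingValuationBalls K2LiuSkewLatticeShells K2LiuLocalSWDualBoxIndex K2LiuWitnessSchwartzBruhat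

variable (F : Type) [Field F] [NumberField F] (E : Type) [Field E] [NumberField E] [Algebra F E]
  [Algebra.IsQuadraticExtension F E] (c : E ≃ₐ[F] E)
  {δ : E} (hcδ : c δ = -δ) (hδ : δ ≠ 0)
  (v : HeightOneSpectrum (𝓞 F)) {π : v.adicCompletion F} (hπ : Valued.v π = WithZero.exp (-1 : ℤ))
  (n : ℕ) {T₀ : Matrix (Fin n) (Fin n) F} (hT₀ : T₀.IsSymm) (hT₀d : IsUnit T₀.det) (ψ : AddChar (v.adicCompletion F) Circle)

/-! ## §1 Continuity of `im_Q` and of the character family -/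

/-- **`im_Q : E ⊗ F_v → F_v` is continuous** (an `F_v`-linear map between finite-dimensional spaces over the complete field `F_v`). [cite: Weil1964, n° 11] -/
theorem continuous_im : Continuous fun z : LocalRing E v => im (quadraticLocalEquiv E v c hcδ hδ).toLinearEquiv.toAddEquiv z := by
  open scoped Valued in
  have h := ((quadraticLocalEquiv E v c hcδ hδ).toLinearEquiv.symm.toContinuousLinearEquiv).continuous
  exact continuous_snd.comp h

/-- **THE CHARACTER FAMILY IS CONTINUOUS IN `x`** for a continuous additive character `ψ_v` and a continuous frame Gram `G̃`. [cite: Weil1964, n° 13] -/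
theorem continuous_charFamily [Invertible (2 : v.adicCompletion F)] (hψ : Continuous ψ) {X : Type*} [TopologicalSpace X]
    {Gt : X → Matrix (Fin n) (Fin n) (LocalRing E v)} (hGt : Continuous Gt) (S t : Matrix (Fin n) (Fin n) (LocalRing E v)) :
    Continuous fun x : X =>
      (ψ (-(⅟(2 : v.adicCompletion F) * im (quadraticLocalEquiv E v c hcδ hδ).toLinearEquiv.toAddEquiv (2 * Matrix.trace (S * t * Gt x)))) : ℂ) := by
  have htr : Continuous fun x : X => 2 * Matrix.trace (S * t * Gt x) :=
    continuous_const.mul ((continuous_const.matrix_mul hGt).matrix_trace)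
  exact continuous_subtype_val.comp (hψ.comp ((continuous_const.mul ((continuous_im F E c hcδ hδ v).comp htr)).neg))

/-- measurability form (★ (W2-d)'s `hmeas`): the character family is a.e.-strongly measurable for every Borel measure. [cite: Weil1964, n° 13] -/
theorem aestronglyMeasurable_charFamily [Invertible (2 : v.adicCompletion F)] (hψ : Continuous ψ) {X : Type*} [TopologicalSpace X] [MeasurableSpace X]
    [OpensMeasurableSpace X] {Gt : X → Matrix (Fin n) (Fin n) (LocalRing E v)} (hGt : Continuous Gt) (S : Matrix (Fin n) (Fin n) (LocalRing E v)) (μ : Measure X)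
    (t : Matrix (Fin n) (Fin n) (LocalRing E v)) :
    AEStronglyMeasurable (fun x : X =>
      (ψ (-(⅟(2 : v.adicCompletion F) * im (quadraticLocalEquiv E v c hcδ hδ).toLinearEquiv.toAddEquiv (2 * Matrix.trace (S * t * Gt x)))) : ℂ)) μ :=
  (continuous_charFamily F E c hcδ hδ v n ψ hψ hGt S t).aestronglyMeasurable

/-! ## §2 Continuity of the frame Gram -/

omit [Algebra.IsQuadraticExtension F E] in
/-- **THE FRAME GRAM IS CONTINUOUS**: `x ↦ (Σ_{k,l} b(x)_{e(j,l)}·D_{kl}·σ(b(x)_{e(i,k)}))_{ji}` for continuous `b : X → (ι′ → E ⊗ F_v)` (★ `continuous_conjLocal`). [cite: Weil1964, n° 11] -/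
theorem continuous_frameGram {X : Type*} [TopologicalSpace X] {ι' κ : Type*} [Fintype κ] {b : X → ι' → LocalRing E v} (hb : Continuous b)
    (e : Fin n × κ → ι') (D : Matrix κ κ (LocalRing E v)) :
    Continuous fun x : X => Matrix.of fun j i => ∑ k, ∑ l, b x (e (j, l)) * D k l * conjLocal E c v (b x (e (i, k))) := by
  refine continuous_matrix fun j i => ?_
  refine continuous_finsetSum _ fun k _ => continuous_finsetSum _ fun l _ => ?_
  have hjl : Continuous fun x => b x (e (j, l)) := (continuous_apply _).comp hb
  have hik : Continuous fun x => b x (e (i, k)) := (continuous_apply _).comp hb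
  exact (hjl.mul continuous_const).mul ((continuous_conjLocal E c v).comp hik)

/-! ## §3 The lattice-pair boxes are compact open -/

omit [Algebra.IsQuadraticExtension F E] in
include hπ in
/-- the product set `{y | (∀ i, v(y₁ i) ≤ V^a) ∧ (∀ i, v(y₂ i) ≤ V^b) ∧ ∀ i, v(y₃ i) ≤ V^c}` in `(E_w²)³` is OPEN. [cite: Shimura1997, §13.2] -/
theorem isOpen_box (w : PlacesOver E v) (a b cc : ℤ) :
    IsOpen {y : (Fin 2 → w.1.adicCompletion E) × (Fin 2 → w.1.adicCompletion E) × (Fin 2 → w.1.adicCompletion E) |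
      (∀ i, Valued.v (y.1 i) ≤ Valued.v (toPlace v w π) ^ a) ∧ (∀ i, Valued.v (y.2.1 i) ≤ Valued.v (toPlace v w π) ^ b) ∧
        ∀ i, Valued.v (y.2.2 i) ≤ Valued.v (toPlace v w π) ^ cc} := by
  have h1 : IsOpen {y : (Fin 2 → w.1.adicCompletion E) × (Fin 2 → w.1.adicCompletion E) × (Fin 2 → w.1.adicCompletion E) |
      ∀ i, Valued.v (y.1 i) ≤ Valued.v (toPlace v w π) ^ a} := by
    rw [Set.setOf_forall]
    exact isOpen_iInter_of_finite fun i => by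
      have hf : Continuous fun y : (Fin 2 → w.1.adicCompletion E) × (Fin 2 → w.1.adicCompletion E) × (Fin 2 → w.1.adicCompletion E) => y.1 i :=
        (continuous_apply i).comp continuous_fst
      exact hf.isOpen_preimage _ (isOpen_setOf_valued_le F E v hπ a w)
  have h2 : IsOpen {y : (Fin 2 → w.1.adicCompletion E) × (Fin 2 → w.1.adicCompletion E) × (Fin 2 → w.1.adicCompletion E) |
      ∀ i, Valued.v (y.2.1 i) ≤ Valued.v (toPlace v w π) ^ b} := by
    rw [Set.setOf_forall]
    exact isOpen_iInter_of_finite fun i => by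
      have hf : Continuous fun y : (Fin 2 → w.1.adicCompletion E) × (Fin 2 → w.1.adicCompletion E) × (Fin 2 → w.1.adicCompletion E) => y.2.1 i :=
        (continuous_apply i).comp (continuous_fst.comp continuous_snd)
      exact hf.isOpen_preimage _ (isOpen_setOf_valued_le F E v hπ b w)
  have h3 : IsOpen {y : (Fin 2 → w.1.adicCompletion E) × (Fin 2 → w.1.adicCompletion E) × (Fin 2 → w.1.adicCompletion E) |
      ∀ i, Valued.v (y.2.2 i) ≤ Valued.v (toPlace v w π) ^ cc} := by
    rw [Set.setOf_forall]
    exact isOpen_iInter_of_finite fun i => by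
      have hf : Continuous fun y : (Fin 2 → w.1.adicCompletion E) × (Fin 2 → w.1.adicCompletion E) × (Fin 2 → w.1.adicCompletion E) => y.2.2 i :=
        (continuous_apply i).comp (continuous_snd.comp continuous_snd)
      exact hf.isOpen_preimage _ (isOpen_setOf_valued_le F E v hπ cc w)
  simp_rw [Set.setOf_and]
  exact h1.inter (h2.inter h3)

omit [Algebra.IsQuadraticExtension F E] in
include hπ in
/-- the same product set is COMPACT (a product of closed balls of the local field `E_w`). [cite: Shimura1997, §13.2] -/
theorem isCompact_box (w : PlacesOver E v) (a b cc : ℤ) :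
    IsCompact {y : (Fin 2 → w.1.adicCompletion E) × (Fin 2 → w.1.adicCompletion E) × (Fin 2 → w.1.adicCompletion E) |
      (∀ i, Valued.v (y.1 i) ≤ Valued.v (toPlace v w π) ^ a) ∧ (∀ i, Valued.v (y.2.1 i) ≤ Valued.v (toPlace v w π) ^ b) ∧
        ∀ i, Valued.v (y.2.2 i) ≤ Valued.v (toPlace v w π) ^ cc} := by
  have hset : {y : (Fin 2 → w.1.adicCompletion E) × (Fin 2 → w.1.adicCompletion E) × (Fin 2 → w.1.adicCompletion E) |
      (∀ i, Valued.v (y.1 i) ≤ Valued.v (toPlace v w π) ^ a) ∧ (∀ i, Valued.v (y.2.1 i) ≤ Valued.v (toPlace v w π) ^ b) ∧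
        ∀ i, Valued.v (y.2.2 i) ≤ Valued.v (toPlace v w π) ^ cc} =
      (Set.univ.pi fun _ : Fin 2 => {x : w.1.adicCompletion E | Valued.v x ≤ Valued.v (toPlace v w π) ^ a}) ×ˢ
        ((Set.univ.pi fun _ : Fin 2 => {x : w.1.adicCompletion E | Valued.v x ≤ Valued.v (toPlace v w π) ^ b}) ×ˢ
          (Set.univ.pi fun _ : Fin 2 => {x : w.1.adicCompletion E | Valued.v x ≤ Valued.v (toPlace v w π) ^ cc})) := by
    ext y
    simp only [Set.mem_setOf_eq, Set.mem_prod, Set.mem_univ_pi]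
  rw [hset]
  exact (isCompact_univ_pi fun _ => isCompact_setOf_valued_le F E v hπ a w).prod
    ((isCompact_univ_pi fun _ => isCompact_setOf_valued_le F E v hπ b w).prod (isCompact_univ_pi fun _ => isCompact_setOf_valued_le F E v hπ cc w))

omit [Algebra.IsQuadraticExtension F E] in
include hπ in
/-- **THE OUTER BOX `B₁ = {A, B ∈ 𝒪², C ∈ (ϖ^k)²}` IS COMPACT OPEN.** [cite: Shimura1997, §13.2] -/
theorem isCompact_isOpen_box_one (w : PlacesOver E v) (k : ℕ) :
    IsCompact {y : (Fin 2 → w.1.adicCompletion E) × (Fin 2 → w.1.adicCompletion E) × (Fin 2 → w.1.adicCompletion E) |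
        (∀ i, Valued.v (y.1 i) ≤ 1) ∧ (∀ i, Valued.v (y.2.1 i) ≤ 1) ∧ ∀ i, Valued.v (y.2.2 i) ≤ Valued.v (toPlace v w π) ^ k} ∧
      IsOpen {y : (Fin 2 → w.1.adicCompletion E) × (Fin 2 → w.1.adicCompletion E) × (Fin 2 → w.1.adicCompletion E) |
        (∀ i, Valued.v (y.1 i) ≤ 1) ∧ (∀ i, Valued.v (y.2.1 i) ≤ 1) ∧ ∀ i, Valued.v (y.2.2 i) ≤ Valued.v (toPlace v w π) ^ k} := by
  have h := isCompact_box F E v hπ w 0 0 (k : ℤ)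
  have h' := isOpen_box F E v hπ w 0 0 (k : ℤ)
  simp only [zpow_zero, zpow_natCast] at h h'
  exact ⟨h, h'⟩

omit [Algebra.IsQuadraticExtension F E] in
include hπ in
/-- **THE INNER BOX `B₂ = B₁ ∩ {B ∈ ϖ𝒪²}` IS COMPACT OPEN.** [cite: Shimura1997, §13.2] -/
theorem isCompact_isOpen_box_two (w : PlacesOver E v) (k : ℕ) :
    IsCompact {y : (Fin 2 → w.1.adicCompletion E) × (Fin 2 → w.1.adicCompletion E) × (Fin 2 → w.1.adicCompletion E) |
        ((∀ i, Valued.v (y.1 i) ≤ 1) ∧ (∀ i, Valued.v (y.2.1 i) ≤ 1) ∧ ∀ i, Valued.v (y.2.2 i) ≤ Valued.v (toPlace v w π) ^ k) ∧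
          ∀ i, Valued.v (y.2.1 i) ≤ Valued.v (toPlace v w π)} ∧
      IsOpen {y : (Fin 2 → w.1.adicCompletion E) × (Fin 2 → w.1.adicCompletion E) × (Fin 2 → w.1.adicCompletion E) |
        ((∀ i, Valued.v (y.1 i) ≤ 1) ∧ (∀ i, Valued.v (y.2.1 i) ≤ 1) ∧ ∀ i, Valued.v (y.2.2 i) ≤ Valued.v (toPlace v w π) ^ k) ∧
          ∀ i, Valued.v (y.2.1 i) ≤ Valued.v (toPlace v w π)} := by
  have hV1 : Valued.v (toPlace v w π) ≤ 1 := valued_toPlace_uniformizer_le_one F E v hπ w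
  have hset : {y : (Fin 2 → w.1.adicCompletion E) × (Fin 2 → w.1.adicCompletion E) × (Fin 2 → w.1.adicCompletion E) |
      ((∀ i, Valued.v (y.1 i) ≤ 1) ∧ (∀ i, Valued.v (y.2.1 i) ≤ 1) ∧ ∀ i, Valued.v (y.2.2 i) ≤ Valued.v (toPlace v w π) ^ k) ∧
        ∀ i, Valued.v (y.2.1 i) ≤ Valued.v (toPlace v w π)} =
      {y | (∀ i, Valued.v (y.1 i) ≤ Valued.v (toPlace v w π) ^ (0 : ℤ)) ∧ (∀ i, Valued.v (y.2.1 i) ≤ Valued.v (toPlace v w π) ^ (1 : ℤ)) ∧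
        ∀ i, Valued.v (y.2.2 i) ≤ Valued.v (toPlace v w π) ^ (k : ℤ)} := by
    ext y
    simp only [Set.mem_setOf_eq, zpow_zero, zpow_one, zpow_natCast]
    exact ⟨fun h => ⟨h.1.1, h.2, h.1.2.2⟩, fun h => ⟨⟨h.1, fun i => (h.2.1 i).trans hV1, h.2.2⟩, h.2.1⟩⟩
  rw [hset]
  exact ⟨isCompact_box F E v hπ w 0 1 k, isOpen_box F E v hπ w 0 1 k⟩

/-! ## §4 Integrability of the witness -/

/-- **THE WITNESS `𝟙_{κ⁻¹B₁} − 𝟙_{κ⁻¹B₂}` IS INTEGRABLE** for a bicontinuous `κ : X ≃ Y`, compact open `B₁, B₂ ⊆ Y`, and a measure finite on compacts (★ (W2-d)'s `hφi`).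
[cite: Tate1950, §2.2] -/
theorem integrable_indicator_sub_indicator {X Y : Type*} [TopologicalSpace X] [T2Space X] [MeasurableSpace X] [OpensMeasurableSpace X] [TopologicalSpace Y]
    (μ : Measure X) [IsFiniteMeasureOnCompacts μ] (κ : X ≃ Y) (hκ : Continuous κ) (hκ' : Continuous κ.symm) {B₁ B₂ : Set Y}
    (h₁c : IsCompact B₁) (h₁o : IsOpen B₁) (h₂c : IsCompact B₂) (h₂o : IsOpen B₂) :
    Integrable ((κ ⁻¹' B₁).indicator (fun _ => (1 : ℂ)) - (κ ⁻¹' B₂).indicator (fun _ => (1 : ℂ))) μ := by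
  have hint : ∀ {B : Set Y}, IsCompact B → IsOpen B → Integrable ((κ ⁻¹' B).indicator fun _ => (1 : ℂ)) μ := fun hBc hBo =>
    (integrable_indicator_iff (isOpen_preimage_equiv κ hκ hBo).measurableSet).2
      ((integrableOn_const_iff (C := (1 : ℂ))).2 (Or.inr (isCompact_preimage_equiv κ hκ' hBc).measure_lt_top))
  exact (hint h₁c h₁o).sub (hint h₂c h₂o)

/-! ## §5 Finiteness of the dual-box quotients -/

include hcδ hδ hπ in
omit hT₀ hT₀d in
/-- **`(S ⊓ Λ_m)⧸(S ⊓ Λ₀)` IS FINITE** (index `q^{4m}`, ★ (B5) `relIndex_inf_box_eq_pow`) — the `Fintype` binders of ★ (T4-core)∕(W2-f) by `Fintype.ofFinite`.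
[cite: Shimura1997, §13.2] -/
theorem finite_quotient_inf_box {T₀' : Matrix (Fin 2) (Fin 2) F} (hT₀' : T₀'.IsSymm) (hT₀'d : IsUnit T₀'.det)
    (S : AddSubgroup (Matrix (Fin 2) (Fin 2) (LocalRing E v)))
    (hS : ∀ t, t ∈ S ↔ (t.map (conjLocal E c v))ᵀ * gramS F E v 2 T₀' + gramS F E v 2 T₀' * t = 0)
    (w₀ : PlacesOver E v) (hw₀ : c • w₀.1 = w₀.1) (hπw : Valued.v (toPlace v w₀ π) = WithZero.exp (-1 : ℤ))
    (hδu : ∀ w : PlacesOver E v, Valued.v (algebraMap E (LocalRing E v) δ w) = 1) (c₀ e₂ : ℤ)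
    (Λ : ℤ → AddSubgroup (Matrix (Fin 2) (Fin 2) (LocalRing E v)))
    (hΛ : ∀ j : ℤ, (Λ j : Set (Matrix (Fin 2) (Fin 2) (LocalRing E v))) = {t | ∀ i i' (w : PlacesOver E v),
      Valued.v ((algebraMap E (LocalRing E v) δ • (gramS F E v 2 T₀' * t)) i i' w) ≤ Valued.v (toPlace v w π) ^ (c₀ - j - if i = i' then e₂ else 0)})
    (m : ℕ) : Finite (↥(S ⊓ Λ (m : ℤ)) ⧸ (S ⊓ Λ 0).addSubgroupOf (S ⊓ Λ (m : ℤ))) := by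
  have h := relIndex_inf_box_eq_pow F E c hcδ hδ v hπ hT₀' hT₀'d S hS w₀ hw₀ hπw hδu c₀ e₂ Λ hΛ m
  have hne : ((S ⊓ Λ 0).addSubgroupOf (S ⊓ Λ (m : ℤ))).index ≠ 0 := by
    rw [← AddSubgroup.relIndex, h]
    have hq : (1 : ℝ) < (v.residueCard : ℝ) := K2LiuGoodPlaceWhittakerUnimodularValueCM.one_lt_residueCard F v
    exact pow_ne_zero _ (by exact_mod_cast (one_pos.trans hq).ne')
  haveI := AddSubgroup.fintypeOfIndexNeZero hne
  exact Finite.of_fintype _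

end Summit.HodgeConjecture.HodgeConjecture.Cruxes.HLiu418.K2LiuWitnessPhaseMeasurable

end
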